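import Summits.NavierStokesRegularity.NavierStokesRegularity.Theorems.ExtremiserTransienceDepletedFractionDefs
import Summits.NavierStokesRegularity.NavierStokesRegularity.Theorems.ExtremiserTransienceDepletedFractionCleanLockedWindow
import HarnessLib

/-!
# Crux `NearExtremalTransiencePerFlow` (stmt-NavierStokesRegularity-26567), LINE g12-β `depleted_fraction`:
# the REGISTERED stub W♭ `stub_cleanLockedWindow : CleanLockedWindow`, BY NAME

The skeleton `Cruxes/NearExtremalTransiencePerFlow/Lines/depleted_fraction.lean` (ns-idea-5 g12, 2f495cb0319b) was registered on
⟨26567⟩ at 2026-08-29T12:54:54Z with stubs `stub_depletedFraction` (X♭, heart, OPEN) and `stub_cleanLockedWindow` (W♭).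
W♭ was proved as `DepletedFraction.cleanLockedWindow_holds` (p719836; type = the body of `CleanLockedWindow` verbatim, co-signed by
idea-crit-4 g9 12:54:27Z) and the texts of record `DepletedFraction.CleanLockedWindow` are the Defs file
`…Theorems.ExtremiserTransienceDepletedFractionDefs`.  This file states the registered stub BY NAME so that the ledger's stub record
closes; the proof is the landed theorem.  HONEST FRAMING: a statement about hypothetical Type-I singular flows violating the crux;
the heart X♭ `DepletedFraction`, the crux ⟨26567⟩ and NS regularity are OPEN; no summit is proved by a line. [folklore]
-/

namespace Summit.NavierStokesRegularity.NavierStokesRegularity.Theorems.NearExtremalTransiencePerFlow.DepletedFraction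

-- the summit's namespace repeats the problem name by convention (D-0017)
set_option linter.dupNamespace false

/-- **W♭, the registered stub `stub_cleanLockedWindow` of LINE g12-β `depleted_fraction`, BY NAME**: a violator has, for every
level `κ⋆/2 ≤ m < κ⋆`, every `η > 0` and every `0 < τ₁ ≤ c_w`, one locked packaged instant with an `η`-clean forward window
(`CleanLockedWindow`, texts of record) — by `cleanLockedWindow_holds` (p719836). [folklore] -/
theorem stub_cleanLockedWindow : CleanLockedWindow := cleanLockedWindow_holds

end Summit.NavierStokesRegularity.NavierStokesRegularity.Theorems.NearExtremalTransiencePerFlow.DepletedFraction
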